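import Literature.MathematicalPhysics.QuantumFieldTheory.Balaban1983to89.B9LettersZQstarFieldsAtPinsL2R
import Literature.MathematicalPhysics.QuantumFieldTheory.Balaban1983to89.B9BackgroundsKLevelV1R
import Literature.MathematicalPhysics.QuantumFieldTheory.Balaban1983to89.Node00.OpsYRecordV4P
import Literature.MathematicalPhysics.QuantumFieldTheory.Balaban1983to89.B9RWSums347DefiniteFaces
import Literature.MathematicalPhysics.QuantumFieldTheory.Balaban1983to89.B9Thm312WholeDir

/-!
# BalabanUVNodes ∕ N06 ([B9], `Dag.B9_main`) — THE FIVE BLOCK-L² `G₀Q\*` ∕ `Q` LETTERS INSIDE THE CERTIFICATE'S PAIR BINDER `hLL2` (`Letters313L2Pk.gQs ∕ dGQs ∕ ddGQs ∕ q`,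
# `Letters313L2MZ.dGQsd`) DERIVED AT THE PINS from the certificate's own G₀ block-L² layer `Thm33G0L2M` (rate δ12₀) and its pins of `Q\*` ∕ `Q` — member-uniformly,
# with produced threshold and ONE constant, at rate δ12₃ (P-DISP 6)

Track A of `YM-PLAN.md` (cell `pub-ymgap`, HUMAN RULING D-0062), node **N06** = [Balaban1985BackgroundPropagators] Thms 3.1–3.15; bundle F7 rows 20–21, seat `pub-ymgap-dag-n06-l`
(g31); memo `DISPLAY-LEDGER-ROWS2021.md` §7 (P-DISP 6); dag-n06-d g20's consumer word «WORTH DOING … type (a) the carrier-generic twin + (b) the leg» (cell INBOX 2026-08-29 22:45Z).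
A HELPER for dag-n06-d's certificate editions after ED.93 «UT».
WHY.  Editions ≥ 93 display `hLL2 : … Letters313L2Pk (𝔬12 x) (𝔡A x).Dd (𝔡A x).Dsd 1 (H x) B13₄ δ12₃ (√n⁻¹) _ U ∧ Letters313L2MZ … B13₄ δ12₃ (√n⁻¹) _ U` (9 + 3 block-L² (3.46)-type
fields), although they DERIVE the G₀ block-L² layer `(hG0C …).2.2 : Thm33G0L2M (𝔬12 x) (𝔡A x).Dd (𝔡A x).Dsd 1 (H x) B12₂ δ12₀ U` (`g0_layer_of_thm310_coreDir₃US(P)`) and hold the pins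
`hQsco12 ∕ hQco12`.  Five of the twelve fields — `gQs` (G₀Q\*), `dGQs` (∇_UG₀Q\*), `ddGQs q` (∇_ν∇_μG₀Q\*), `q` (Q) and `dGQsd ν` (∇_{U,ν}G₀Q\*) — are compositions of that layer's
fields `l0 ∕ l1 ∕ l3 ∕ l1d` with the pinned block-L² letters of `Q\*` ∕ `Q` (dag-n06-w5's route; carrier-generic twins `B9LettersZQstarFieldsAtPinsL2R.gQs_l2_pinsB ∕ dGQs_l2_pinsB ∕
ddGQs_l2_pinsB ∕ dGQsd_l2_pinsB ∕ q_l2_pinsB`, this seat), above the [4] (2.60) member threshold `log L ≤ ε(2L²−1)M`.  THIS FILE discharges that threshold at the geometry of record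
(`ε := 1`: every member with `M ≥ log(ℓ+1)` passes, since `1 ≤ L ≤ ℓ+1` and `2(ℓ+1)²−1 ≥ 1`), the row sum by `rowSum261_geo9Y` at rate 1, reads «`U` is SU(N)-valued» off the class
axiom (`mem_of_reg335R hGR`), and packages everything in the certificate's binder shapes: ★★★ `g0qstar_l2_letters_of_pins` — ∃ `ML ≥ M12`, `BL ≥ 0` such that above `ML` the five
fields hold at `(BL, δ12₃)` with the `√n⁻¹` weight VERBATIM (rates: `Q\*`∕`Q` letters at `δ12₃ + 1`, output `δ12₃ ≤ δ12₀`; no new numeric — `0 ≤ δ12₃ ≤ δ12₀`, `0 ≤ B12₂` are the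
layer's own).  The knit (dag-n06-d): assemble `hLL2`'s two records from the 4 + 2 still-displayed fields (`gDv dGDv rgdI rgdDs c1` ∕ `dGDvd rgdDd`, at `max B13₄ BL` by `.mono`)
and these five (anonymous constructors, the W1-bis pattern).
HONEST FRAMING.  By-name composition of kernel-checked helper files; the G₀ block-L² layer is a HYPOTHESIS (the certificate's derived layer); COUNT-NEUTRAL; nothing of [B9]'s
propagator estimates asserted; N06 NOT discharged; K1 NOT closed; one finite 𝕋⁴ programme at fixed `ε` — NOT continuum, NOT OS, NOT the mass gap ∕ Clay.  0 `def`, 0 `sorry`.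
-/

noncomputable section

namespace Summit.QuantumFields.YangMills.BalabanUVNodes.N06G0QstarL2LettersLegAtPinsPU

open scoped Matrix.Norms.L2Operator
open Literature.MathematicalPhysics.QuantumFieldTheory.Balaban1983to89
open Literature.MathematicalPhysics.QuantumFieldTheory.Balaban1983to89.Node00
open Literature.MathematicalPhysics.QuantumFieldTheory.Balaban1983to89.B9PinMembersKLevelV1 (MemberY geo9Y bg9Y)
open Literature.MathematicalPhysics.QuantumFieldTheory.Balaban1983to89.B9BackgroundsKLevelV1R (RegFamY bg9YR MemOfFam mem_of_reg335R)
open Literature.MathematicalPhysics.QuantumFieldTheory.Balaban1983to89.B7Prop2SpecialUnitary (specialUnitaryUnits)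
open Literature.MathematicalPhysics.QuantumFieldTheory.Balaban1983to89.B6GlobalChartV1 (blkV1)
open Literature.MathematicalPhysics.QuantumFieldTheory.Balaban1983to89.B6Ineq2142KLevelV1 (β lvl)
open Literature.MathematicalPhysics.QuantumFieldTheory.Balaban1983to89.B6Geom246MultiLevelTorus (geomT)
open Literature.MathematicalPhysics.QuantumFieldTheory.Balaban1983to89.B9CoReadingCoordsTranspose (TrIdx trBasis)
open Literature.MathematicalPhysics.QuantumFieldTheory.Balaban1983to89.B9CoReadingCoords (XBK blkBK)
open Literature.MathematicalPhysics.QuantumFieldTheory.Balaban1983to89.B9CoReadingCoordsH (XHK blkHK)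
open Literature.MathematicalPhysics.QuantumFieldTheory.Balaban1983to89.B9GeoNormsKLevelV1 (geo9K geo9K_dist_nonneg)
open Literature.MathematicalPhysics.QuantumFieldTheory.Balaban1983to89.B9GeoLemma21KLevelV1 (geo9Y_dist_triangle geo9Y_dist_comm geo9Y_len_pos rowSum261_geo9Y geo9K_one_le_L)
open Literature.MathematicalPhysics.QuantumFieldTheory.Balaban1983to89.B9Thm34Ext (toB6)
open Literature.MathematicalPhysics.QuantumFieldTheory.Balaban1983to89.B9SectDL2Decay (BlockBd)
open Literature.MathematicalPhysics.QuantumFieldTheory.Balaban1983to89.B11SectG (RowSum)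
open Literature.MathematicalPhysics.QuantumFieldTheory.Balaban1983to89.B9Thm312Whole (Ops GeoOK)
open Literature.MathematicalPhysics.QuantumFieldTheory.Balaban1983to89.B9Thm312WholeDir (Thm33G0L2M)
open Literature.MathematicalPhysics.QuantumFieldTheory.Balaban1983to89.B9RWSums347DefiniteFaces (geo9Y_scalars)
open Literature.MathematicalPhysics.QuantumFieldTheory.Balaban1983to89.Node00.OpsYSectDCoords (QscoKH QcoKH)
open Literature.MathematicalPhysics.QuantumFieldTheory.Balaban1983to89.B9LettersZQstarFieldsAtPinsL2R (gQs_l2_pinsB dGQs_l2_pinsB dGQsd_l2_pinsB ddGQs_l2_pinsB q_l2_pinsB)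

variable {N : ℕ}

/-- ★★★ **THE FIVE BLOCK-L² `G₀Q\*` ∕ `Q` LETTERS AT THE PINS, MEMBER-UNIFORMLY, FROM THE G₀ BLOCK-L² LAYER** (module docstring): from `Thm33G0L2M … B12₂ δ12₀ U` (fields
`l0 l1 l3 l1d`), the block maps, the pins of `Q\*` and `Q`, `0 ≤ B12₂` and `0 ≤ δ12₃ ≤ δ12₀`, ONE `obtain` gives `ML ≥ M12`, `BL ≥ 0` and, above `ML`, the fields `gQs`, `dGQs`,
`ddGQs q` (every pair), `dGQsd ν` (every direction) and `q` of `Letters313L2Pk ∕ Letters313L2MZ` at constant `BL`, rate `δ12₃`, weight `v_Z = √(n⁻¹)`.  Inside: row sum at rate 1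
(`rowSum261_geo9Y`), the (2.60) threshold at `ε := 1` from `1 ≤ L ≤ ℓ+1`, the R-generic twins of w5's block-L² letters.
[cite: Balaban1985BackgroundPropagators, Thm 3.13 p.426, (3.153) p.426, (3.46) p.398, p.398 (remark after (3.47)), (3.110) p.417, (3.13) p.393; Balaban1984PropagatorsII, (2.26) p.228, Lemma 2.1 (2.60)–(2.61) p.234; Balaban1984PropagatorsI, (1.18) p.20] -/
theorem g0qstar_l2_letters_of_pins (θ : Stage3Params) (Mstar : ℕ) {R₁ R₂ : RegFamY θ.d₆ θ.ℓ₆ θ.hd' θ.hL' θ.b₀ θ.b₁ Mstar (Matrix (Fin N) (Fin N) ℂ)} {c : ℝ}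
    (hGR : MemOfFam (specialUnitaryUnits (Fin N)) R₁)
    [∀ x : MemberY θ.d₆ θ.ℓ₆ θ.hd' θ.hL' θ.b₀ θ.b₁ Mstar, Fintype (geo9Y x).Site]
    (bI : ∀ x : MemberY θ.d₆ θ.ℓ₆ θ.hd' θ.hL' θ.b₀ θ.b₁ Mstar, FBondY x.toKIdx → IBondY x.toKIdx)
    (hβ1 : ∀ (x : MemberY θ.d₆ θ.ℓ₆ θ.hd' θ.hL' θ.b₀ θ.b₁ Mstar) (f : FBondY x.toKIdx), (geomT x.D).dist (β x.hN x.D x.hk (bI x f)) (blkV1 x.hN x.D f) ≤ 1)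
    (H12 : MemberY θ.d₆ θ.ℓ₆ θ.hd' θ.hL' θ.b₀ θ.b₁ Mstar → Prop) {W12 : MemberY θ.d₆ θ.ℓ₆ θ.hd' θ.hL' θ.b₀ θ.b₁ Mstar → Type} [∀ x, Fintype (W12 x)]
    (𝔬12 : ∀ x : MemberY θ.d₆ θ.ℓ₆ θ.hd' θ.hL' θ.b₀ θ.b₁ Mstar, B9Thm312Whole.Ops (geo9Y x) (bg9YR (Matrix (Fin N) (Fin N) ℂ) (specialUnitaryUnits (Fin N)) R₁ R₂ x) (XBK (TrIdx N) x.toKIdx) (XBK (TrIdx N) x.toKIdx) (XHK (TrIdx N) x.toKIdx) (W12 x))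
    (Dd Dds : ∀ x : MemberY θ.d₆ θ.ℓ₆ θ.hd' θ.hL' θ.b₀ θ.b₁ Mstar, (bg9YR (Matrix (Fin N) (Fin N) ℂ) (specialUnitaryUnits (Fin N)) R₁ R₂ x).Cfg → Fin (θ.d₆ + 1) → Module.End ℝ (XBK (TrIdx N) x.toKIdx → ℝ))
    (hblk12 : ∀ x : MemberY θ.d₆ θ.ℓ₆ θ.hd' θ.hL' θ.b₀ θ.b₁ Mstar, (𝔬12 x).blk = blkBK x.toKIdx (bI x)) (hblkZ12 : ∀ x : MemberY θ.d₆ θ.ℓ₆ θ.hd' θ.hL' θ.b₀ θ.b₁ Mstar, (𝔬12 x).blkZ = blkHK x.toKIdx)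
    (hQsco12 : ∀ (x : MemberY θ.d₆ θ.ℓ₆ θ.hd' θ.hL' θ.b₀ θ.b₁ Mstar) (U : (bg9YR (Matrix (Fin N) (Fin N) ℂ) (specialUnitaryUnits (Fin N)) R₁ R₂ x).Cfg), (𝔬12 x).Qstar U = QscoKH x.toKIdx (trBasis N) (bg9YR (Matrix (Fin N) (Fin N) ℂ) (specialUnitaryUnits (Fin N)) R₁ R₂ x) (fun U => U) (parBY x.toKIdx) U)
    (hQco12 : ∀ (x : MemberY θ.d₆ θ.ℓ₆ θ.hd' θ.hL' θ.b₀ θ.b₁ Mstar) (U : (bg9YR (Matrix (Fin N) (Fin N) ℂ) (specialUnitaryUnits (Fin N)) R₁ R₂ x).Cfg), (𝔬12 x).Q U = QcoKH x.toKIdx (trBasis N) (bg9YR (Matrix (Fin N) (Fin N) ℂ) (specialUnitaryUnits (Fin N)) R₁ R₂ x) (fun U => U) (parBY x.toKIdx) U)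
    {M12 a12 B12₂ δ12₀ δ12₃ : ℝ} (hB12₂ : 0 ≤ B12₂) (hδ30 : 0 ≤ δ12₃) (hδ₃₀ : δ12₃ ≤ δ12₀)
    (hL2 : ∀ x : MemberY θ.d₆ θ.ℓ₆ θ.hd' θ.hL' θ.b₀ θ.b₁ Mstar, M12 ≤ (geo9Y x).M → ∀ α₀ : ℝ, 0 < α₀ → (geo9Y x).M * α₀ ≤ a12 → ∀ U : (bg9YR (Matrix (Fin N) (Fin N) ℂ) (specialUnitaryUnits (Fin N)) R₁ R₂ x).Cfg, (bg9YR (Matrix (Fin N) (Fin N) ℂ) (specialUnitaryUnits (Fin N)) R₁ R₂ x).Reg335 c α₀ U →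
      (bg9YR (Matrix (Fin N) (Fin N) ℂ) (specialUnitaryUnits (Fin N)) R₁ R₂ x).Reg336 c α₀ U → Thm33G0L2M (𝔬12 x) (Dd x) (Dds x) 1 (H12 x) B12₂ δ12₀ U) :
    ∃ (ML BL : ℝ), M12 ≤ ML ∧ 0 ≤ BL ∧
      ∀ x : MemberY θ.d₆ θ.ℓ₆ θ.hd' θ.hL' θ.b₀ θ.b₁ Mstar, ML ≤ (geo9Y x).M → ∀ α₀ : ℝ, 0 < α₀ → (geo9Y x).M * α₀ ≤ a12 → ∀ U : (bg9YR (Matrix (Fin N) (Fin N) ℂ) (specialUnitaryUnits (Fin N)) R₁ R₂ x).Cfg, (bg9YR (Matrix (Fin N) (Fin N) ℂ) (specialUnitaryUnits (Fin N)) R₁ R₂ x).Reg335 c α₀ U → (bg9YR (Matrix (Fin N) (Fin N) ℂ) (specialUnitaryUnits (Fin N)) R₁ R₂ x).Reg336 c α₀ U →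
        BlockBd (g := toB6 (geo9Y x) 1 (H12 x)) (𝔬12 x).blkZ (𝔬12 x).blk ((𝔬12 x).G0 U ∘ₗ (𝔬12 x).Qstar U)
          (fun (y y' : (geo9Y x).Site) => BL * (geo9Y x).len y * (Real.sqrt (((((θ.ℓ₆ + 1 : ℕ) : ℝ) ^ (θ.d₆ + 1)) ^ lvl x.hN x.D x.hk y')⁻¹) * (geo9Y x).len y') * Real.exp (-(δ12₃ * (geo9Y x).dist y y'))) ∧
        BlockBd (g := toB6 (geo9Y x) 1 (H12 x)) (𝔬12 x).blkZ (𝔬12 x).blkY ((𝔬12 x).D U ∘ₗ (𝔬12 x).G0 U ∘ₗ (𝔬12 x).Qstar U)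
          (fun (y y' : (geo9Y x).Site) => BL * (Real.sqrt (((((θ.ℓ₆ + 1 : ℕ) : ℝ) ^ (θ.d₆ + 1)) ^ lvl x.hN x.D x.hk y')⁻¹) * (geo9Y x).len y') * Real.exp (-(δ12₃ * (geo9Y x).dist y y'))) ∧
        (∀ q : Fin (θ.d₆ + 1) × Fin (θ.d₆ + 1),
          BlockBd (g := toB6 (geo9Y x) 1 (H12 x)) (𝔬12 x).blkZ (𝔬12 x).blk ((Dd x U q.1 ∘ₗ Dd x U q.2) ∘ₗ (𝔬12 x).G0 U ∘ₗ (𝔬12 x).Qstar U)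
            (fun (y y' : (geo9Y x).Site) => BL * (((geo9Y x).len y)⁻¹ * (Real.sqrt (((((θ.ℓ₆ + 1 : ℕ) : ℝ) ^ (θ.d₆ + 1)) ^ lvl x.hN x.D x.hk y')⁻¹) * (geo9Y x).len y')) * Real.exp (-(δ12₃ * (geo9Y x).dist y y')))) ∧
        (∀ ν : Fin (θ.d₆ + 1),
          BlockBd (g := toB6 (geo9Y x) 1 (H12 x)) (𝔬12 x).blkZ (𝔬12 x).blk (Dd x U ν ∘ₗ (𝔬12 x).G0 U ∘ₗ (𝔬12 x).Qstar U)
            (fun (y y' : (geo9Y x).Site) => BL * (Real.sqrt (((((θ.ℓ₆ + 1 : ℕ) : ℝ) ^ (θ.d₆ + 1)) ^ lvl x.hN x.D x.hk y')⁻¹) * (geo9Y x).len y') * Real.exp (-(δ12₃ * (geo9Y x).dist y y')))) ∧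
        BlockBd (g := toB6 (geo9Y x) 1 (H12 x)) (𝔬12 x).blk (𝔬12 x).blkZ ((𝔬12 x).Q U)
          (fun (y y' : (geo9Y x).Site) => BL * (Real.sqrt (((((θ.ℓ₆ + 1 : ℕ) : ℝ) ^ (θ.d₆ + 1)) ^ lvl x.hN x.D x.hk y)⁻¹) * (geo9Y x).len y * ((geo9Y x).len y')⁻¹) * Real.exp (-(δ12₃ * (geo9Y x).dist y y'))) := by
  -- a [4] (2.61) row sum at rate 1 (only its constant enters)
  obtain ⟨MR, cL, hrowL⟩ := rowSum261_geo9Y (d := θ.d₆) (ℓ := θ.ℓ₆) (hd := θ.hd') (hL := θ.hL') (b₀ := θ.b₀) (b₁ := θ.b₁) (Mstar := Mstar) 1 one_pos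
  have hrow : ∀ x : MemberY θ.d₆ θ.ℓ₆ θ.hd' θ.hL' θ.b₀ θ.b₁ Mstar, MR ≤ (geo9Y x).M → RowSum (toB6 (geo9Y x) 1 (H12 x)) 1 (max cL 0) := fun x hM y => (hrowL x hM y).trans (le_max_left _ _)
  -- the (2.60) transfer threshold at ε := 1: `log L ≤ (2L²−1)·M` for every member with `M ≥ log(ℓ+1)`
  have hL1 : (1 : ℝ) ≤ ((θ.ℓ₆ + 1 : ℕ) : ℝ) := by exact_mod_cast Nat.succ_le_succ (Nat.zero_le _)
  have hlog0 : 0 ≤ Real.log (((θ.ℓ₆ + 1 : ℕ) : ℝ)) := Real.log_nonneg hL1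
  -- the produced constant: E₀ = (ℓ+1)·e^{(δ12₃+2)(ℓ+4)} dominates the member's `L·e^{(δ_Q+ε)(ℓ+4)}`; BL = B12₂·E₀·c + E₀ serves the four composites and the `Q` line
  set E₀ : ℝ := (((θ.ℓ₆ + 1 : ℕ) : ℝ)) * Real.exp ((δ12₃ + 1 + 1) * ((θ.ℓ₆ : ℝ) + 4)) with hE₀
  have hE₀0 : 0 ≤ E₀ := mul_nonneg (Nat.cast_nonneg _) (Real.exp_nonneg _)
  have hc0 : (0 : ℝ) ≤ max cL 0 := le_max_right _ _
  have hBE : 0 ≤ B12₂ * E₀ * max cL 0 := mul_nonneg (mul_nonneg hB12₂ hE₀0) hc0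
  have hδQ : (0 : ℝ) ≤ δ12₃ + 1 := by linarith
  have hρQ' : δ12₃ ≤ δ12₃ + 1 := by linarith
  refine ⟨max M12 (max MR (Real.log (((θ.ℓ₆ + 1 : ℕ) : ℝ)))), B12₂ * E₀ * max cL 0 + E₀, le_max_left _ _, add_nonneg hBE hE₀0,
    fun x hM α₀ hα ha U hU hU' => ?_⟩
  letI : Fintype (geo9K x.toKIdx).Site := (inferInstance : Fintype (geo9Y x).Site)
  have hM12x : M12 ≤ (geo9Y x).M := (le_max_left _ _).trans hM
  have hMRx : MR ≤ (geo9Y x).M := ((le_max_left _ _).trans (le_max_right _ _)).trans hM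
  have hMlog : Real.log (((θ.ℓ₆ + 1 : ℕ) : ℝ)) ≤ (geo9Y x).M := ((le_max_right _ _).trans (le_max_right _ _)).trans hM
  have hUG := mem_of_reg335R hGR x hU
  have hL2x := hL2 x hM12x α₀ hα ha U hU hU'
  have hLx : (geo9Y x).L ≤ ((θ.ℓ₆ + 1 : ℕ) : ℝ) := (geo9Y_scalars x).2.1
  have hLpos : 0 < (geo9Y x).L := lt_of_lt_of_le one_pos (geo9K_one_le_L x.toKIdx)
  have hMth : Real.log (geo9Y x).L ≤ 1 * (2 * ((θ.ℓ₆ : ℝ) + 1) ^ 2 - 1) * (geo9Y x).M := by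
    have h21 : (1 : ℝ) ≤ 2 * ((θ.ℓ₆ : ℝ) + 1) ^ 2 - 1 := by nlinarith [Nat.cast_nonneg (α := ℝ) θ.ℓ₆]
    have hM0 : 0 ≤ (geo9Y x).M := hlog0.trans hMlog
    calc Real.log (geo9Y x).L ≤ Real.log (((θ.ℓ₆ + 1 : ℕ) : ℝ)) := Real.log_le_log hLpos hLx
      _ ≤ (geo9Y x).M := hMlog
      _ ≤ (2 * ((θ.ℓ₆ : ℝ) + 1) ^ 2 - 1) * (geo9Y x).M := le_mul_of_one_le_left hM0 h21
      _ = 1 * (2 * ((θ.ℓ₆ : ℝ) + 1) ^ 2 - 1) * (geo9Y x).M := by ring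
  have hLE : (geo9Y x).L * Real.exp ((δ12₃ + 1 + 1) * ((θ.ℓ₆ : ℝ) + 4)) ≤ E₀ := by
    rw [hE₀]; exact mul_le_mul_of_nonneg_right hLx (Real.exp_nonneg _)
  have hB4 : B12₂ * ((geo9Y x).L * Real.exp ((δ12₃ + 1 + 1) * ((θ.ℓ₆ : ℝ) + 4))) * max cL 0 ≤ B12₂ * E₀ * max cL 0 + E₀ :=
    (mul_le_mul_of_nonneg_right (mul_le_mul_of_nonneg_left hLE hB12₂) hc0).trans (le_add_of_nonneg_right hE₀0)
  have hB4q : (geo9Y x).L * Real.exp ((δ12₃ + 1 + 1) * ((θ.ℓ₆ : ℝ) + 4)) ≤ B12₂ * E₀ * max cL 0 + E₀ := hLE.trans (le_add_of_nonneg_left hBE)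
  refine ⟨?_, ?_, ?_, ?_, ?_⟩
  · exact gQs_l2_pinsB x (hβ1 x) (B := (bg9YR (Matrix (Fin N) (Fin N) ℂ) (specialUnitaryUnits (Fin N)) R₁ R₂ x)) (cfg := fun U => U) (𝔬 := 𝔬12 x) (H := H12 x) (B₂ := B12₂) (δ₁ := δ12₀) (σ := 1) (c := max cL 0) (ρ := δ12₃)
      (δQ := δ12₃ + 1) (ε := 1) (B₄ := B12₂ * E₀ * max cL 0 + E₀) (U := U) hUG (hrow x hMRx) hB12₂ hδQ one_pos hMth hδ30 hδ₃₀ le_rfl hB4 (hblk12 x) (hblkZ12 x)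
      (hQsco12 x U) hL2x.l0
  · exact dGQs_l2_pinsB x (hβ1 x) (B := (bg9YR (Matrix (Fin N) (Fin N) ℂ) (specialUnitaryUnits (Fin N)) R₁ R₂ x)) (cfg := fun U => U) (𝔬 := 𝔬12 x) (H := H12 x) (B₂ := B12₂) (δ₁ := δ12₀) (σ := 1) (c := max cL 0) (ρ := δ12₃)
      (δQ := δ12₃ + 1) (ε := 1) (B₄ := B12₂ * E₀ * max cL 0 + E₀) (U := U) hUG (hrow x hMRx) hB12₂ hδQ one_pos hMth hδ30 hδ₃₀ le_rfl hB4 (hblk12 x) (hblkZ12 x)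
      (hQsco12 x U) hL2x.l1
  · exact ddGQs_l2_pinsB x (hβ1 x) (B := (bg9YR (Matrix (Fin N) (Fin N) ℂ) (specialUnitaryUnits (Fin N)) R₁ R₂ x)) (cfg := fun U => U) (𝔬 := 𝔬12 x) (Dd := Dd x) (H := H12 x) (B₂ := B12₂) (δ₁ := δ12₀) (σ := 1) (c := max cL 0)
      (ρ := δ12₃) (δQ := δ12₃ + 1) (ε := 1) (B₄ := B12₂ * E₀ * max cL 0 + E₀) (U := U) hUG (hrow x hMRx) hB12₂ hδQ one_pos hMth hδ30 hδ₃₀ le_rfl hB4 (hblk12 x)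
      (hblkZ12 x) (hQsco12 x U) hL2x.l3
  · exact dGQsd_l2_pinsB x (hβ1 x) (B := (bg9YR (Matrix (Fin N) (Fin N) ℂ) (specialUnitaryUnits (Fin N)) R₁ R₂ x)) (cfg := fun U => U) (𝔬 := 𝔬12 x) (Dd := Dd x) (H := H12 x) (B₂ := B12₂) (δ₁ := δ12₀) (σ := 1) (c := max cL 0)
      (ρ := δ12₃) (δQ := δ12₃ + 1) (ε := 1) (B₄ := B12₂ * E₀ * max cL 0 + E₀) (U := U) hUG (hrow x hMRx) hB12₂ hδQ one_pos hMth hδ30 hδ₃₀ le_rfl hB4 (hblk12 x)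
      (hblkZ12 x) (hQsco12 x U) hL2x.l1d
  · exact q_l2_pinsB x (hβ1 x) (B := (bg9YR (Matrix (Fin N) (Fin N) ℂ) (specialUnitaryUnits (Fin N)) R₁ R₂ x)) (cfg := fun U => U) (𝔬 := 𝔬12 x) (H := H12 x) (ρ := δ12₃) (δQ := δ12₃ + 1) (ε := 1)
      (B₄ := B12₂ * E₀ * max cL 0 + E₀) (U := U) hUG hδQ one_pos hMth hρQ' hB4q (hblk12 x) (hblkZ12 x) (hQco12 x U)

end Summit.QuantumFields.YangMills.BalabanUVNodes.N06G0QstarL2LettersLegAtPinsPU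

end
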